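import Literature.NumberTheory.Transcendental.KZFibredRelations
import Literature.NumberTheory.Transcendental.KZDominatedFamily
import Literature.NumberTheory.Transcendental.KZKernelConjectureForms
import Summits.KontsevichZagierPeriods.KontsevichZagierPeriods.Theses.ValuedFieldSpecialisation
import Summits.KontsevichZagierPeriods.KontsevichZagierPeriods.Theorems.ValuedFieldSpecialisationCTConstructionConstantTermOfNormalForm

/-!
# Route ValuedFieldSpecialisation — crux `ParametricLifting` (stmt-KontsevichZagierPeriods-3498):
THE STRENGTH OF THE CRUX AND ITS EXACT COMPLEMENT

Helper (`--supports`) for item stmt-KontsevichZagierPeriods-3498 (line `registered`, lead c2). The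
crux `ParametricLifting` (PL) says: for rational representations `r`, `r'` with equal value there is
a FIBRED relation `G = Σ mᵢ [Rᵢ]` whose net is a `ℤ`-combination of DOMINATED families with special
fibres `r₀ᵢ` and `Σ mᵢ [r₀ᵢ] − ([r] − [r']) ∈ KZ.relations`. This file pins its logical position
in the route, with no new definition (the complement SF is written out in the theorem types, in the
tree's vocabulary `KZ.fibredRelations` / `KZ.IsDominatedFamily`, which are definitionally the
clauses inlined in the route declarations):

* `parametricLifting_of_kontsevichZagierPeriods` — **summit ⇒ PL** (take the EMPTY net, `G = 0`):
  the crux is not stronger than the summit (its docstring's "implied by it with `G := 0`", now a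
  tree theorem).
* SF, *special fibres of dominated fibred relations are relations*: if `Σ mᵢ [Rᵢ] ∈
  KZ.fibredRelations` with every `Rᵢ` dominated near `s = 0⁺` with special fibre `r₀ᵢ`, then
  `Σ mᵢ [r₀ᵢ] ∈ KZ.relations`.
  - `eval_specialFibre_eq_zero` — its VALUE shadow is a theorem: `KZ.eval (Σ mᵢ [r₀ᵢ]) = 0`
    (slices of fibred relations vanish a.e., `KZ.sliceEval_ae_eq_zero`; dominated slices converge,
    `KZ.IsDominatedFamily.tendsto_setIntegral`; uniqueness of limits along the non-trivial filter
    `𝓝[>] 0 ⊓ 𝓟 {good parameters}`).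
  - `specialFibre_of_kzKernelConjecture`, `specialFibre_of_kontsevichZagierPeriods` — hence SF is
    implied by the kernel conjecture, i.e. by the summit (`kzKernelConjecture_iff_isRational`).
  - `specialFibre_of_ctConstruction` — SF is what the thesis-bearing crux `CTConstruction`
    delivers to the assembly ((CT2) + (CT3)).
  - `kontsevichZagierPeriods_of_specialFibre_of_parametricLifting` — **SF ⇒ PL ⇒ summit** (the
    assembly with `CTConstruction` weakened to SF).
* `kontsevichZagierPeriods_iff_parametricLifting_and_specialFibre` — **summit ⇔ PL ∧ SF**: the
  route's cut of Conjecture 1 into "lift the pair to a fibred relation with dominated net" and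
  "specialise dominated fibred relations" is LOSSLESS (both halves are consequences of the summit
  and jointly give it back).

Consequence recorded for the line chain (`Cruxes/ParametricLifting/Lines/`): PL is summit-implied and
summit-equivalent modulo SF; the residual stubs of line `registered` are S1 ⟸ summit and
S3b ⟺ `KZKernelConjecture` (file `…ParametricLiftingCoefficientClassesStrength`), so that line closes
PL only through the summit.

Sources: M. Kontsevich, D. Zagier, *Periods* (2001), §1.2, Conjecture 1; A. Huber, S. Müller-Stach,
*Periods and Nori Motives* (2017), Conj. 13.2.1 (kernel form); Lebesgue's dominated convergence.
The fibred/dominated vocabulary is this route's (`KZFibredRelations.lean`, `KZDominatedFamily.lean`).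
-/

noncomputable section

namespace Summit.KontsevichZagierPeriods.ValuedFieldSpecialisation

open MeasureTheory Set Filter
open scoped Topology
open Literature.NumberTheory.Transcendental
open Summit.KontsevichZagierPeriods.KontsevichZagierPeriods.Theses.ValuedFieldSpecialisation
  (ParametricLifting CTConstruction)

/-- **Summit ⇒ `ParametricLifting`** (the crux is not stronger than the summit): under
`KontsevichZagierPeriods` take the EMPTY dominated net, `k = 0`, `G = 0 ∈` the fibred subgroup; the
special-fibre condition becomes `-( [r] - [r'] ) ∈ KZ.relations`, the conjecture for the pair.
[Kontsevich–Zagier 2001, §1.2 Conjecture 1] [folklore] -/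
theorem parametricLifting_of_kontsevichZagierPeriods (hKZ : KontsevichZagierPeriods) :
    ParametricLifting := by
  intro n m r r' hr hr' hv
  refine ⟨0, AddSubgroup.zero_mem _, 0, Fin.elim0, Fin.elim0, fun i => i.elim0, fun i => i.elim0,
    fun i => i.elim0, fun i => i.elim0, by simp, ?_⟩
  simp only [Finset.univ_eq_empty, Finset.sum_empty, zero_sub]
  exact KZ.relations.neg_mem (hKZ r r' hr hr' hv)

/-- **The kernel conjecture ⇒ `ParametricLifting`** (via the summit,
`kzKernelConjecture_iff_isRational`). [Kontsevich–Zagier 2001, §1.2 Conjecture 1] [folklore] -/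
theorem parametricLifting_of_kzKernelConjecture (hK : KZKernelConjecture) : ParametricLifting :=
  parametricLifting_of_kontsevichZagierPeriods (kzKernelConjecture_iff_isRational.mp hK)

/-! ### SF — special fibres of dominated fibred relations -/

/-- **Value shadow of SF (unconditional): the special fibres of a dominated fibred relation sum to
zero at value level.** If `Σ mᵢ [Rᵢ] ∈ KZ.fibredRelations` and every `Rᵢ` is dominated near
`s = 0⁺` with special fibre `r₀ᵢ` (`KZ.IsDominatedFamily (R i) (r₀ i) (g i)`), then
`KZ.eval (Σ mᵢ [r₀ᵢ]) = Σ mᵢ (r₀ᵢ).value = 0`. Proof: the slice function of a fibred relation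
vanishes a.e. in the parameter (`KZ.sliceEval_ae_eq_zero`), the slices of the dominated net tend to
`Σ mᵢ (r₀ᵢ).value` as `s → 0⁺` (Lebesgue, `KZ.IsDominatedFamily.tendsto_setIntegral`), and both
happen along the non-trivial filter `𝓝[>] 0 ⊓ 𝓟 {s | sliceEval = 0}`
(`nhdsGT_inf_principal_neBot_of_volume_compl_eq_zero`), so the limit is `0`
(`tendsto_nhds_unique`). [Kontsevich–Zagier 2001, §1.2; Lebesgue] [folklore] -/
theorem eval_specialFibre_eq_zero {k : ℕ} {d : Fin k → ℕ} (m : Fin k → ℤ)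
    {R : (i : Fin k) → KZ.IntegralRep (d i + 1)} {r₀ g : (i : Fin k) → KZ.IntegralRep (d i)}
    (hR : ∀ i, KZ.IsDominatedFamily (R i) (r₀ i) (g i))
    (hG : (∑ i, m i • KZ.of (R i)) ∈ KZ.fibredRelations) :
    KZ.eval (∑ i, m i • KZ.of (r₀ i)) = 0 := by
  -- the value of the special-fibre class
  have heval : KZ.eval (∑ i, m i • KZ.of (r₀ i)) = ∑ i, (m i : ℝ) * (r₀ i).value := by
    simp only [map_sum, map_zsmul, KZ.eval_of, zsmul_eq_mul]
  -- the slices of the dominated net converge to it as `s → 0⁺` (Lebesgue)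
  have hN : Tendsto (KZ.sliceEval (∑ i, m i • KZ.of (R i))) (𝓝[>] 0)
      (𝓝 (∑ i, (m i : ℝ) * (r₀ i).value)) := by
    have heq : KZ.sliceEval (∑ i, m i • KZ.of (R i)) =
        fun s => ∑ i, (m i : ℝ) * KZ.sliceValue (R i) s := by
      funext s
      simp only [map_sum, map_zsmul, KZ.sliceEval_of, Finset.sum_apply, Pi.smul_apply]
      simp only [zsmul_eq_mul]
    rw [heq]
    exact tendsto_finsetSum _ fun i _ => (hR i).tendsto_setIntegral.const_mul _
  -- the slices of the fibred relation vanish a.e.: the set of good parameters is co-null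
  have hAc : volume {s : ℝ | KZ.sliceEval (∑ i, m i • KZ.of (R i)) s = 0}ᶜ = 0 := by
    rw [compl_setOf]
    refine ae_iff.1 ?_
    filter_upwards [KZ.sliceEval_ae_eq_zero hG] with s hs
    simpa only [Pi.zero_apply] using hs
  have hl := nhdsGT_inf_principal_neBot_of_volume_compl_eq_zero hAc
  have hle : 𝓝[>] (0 : ℝ) ⊓ 𝓟 {s : ℝ | KZ.sliceEval (∑ i, m i • KZ.of (R i)) s = 0} ≤
      𝓝[>] (0 : ℝ) := inf_le_left
  -- along the restricted filter the slice function is identically `0` and tends to the value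
  have h0 : Tendsto (KZ.sliceEval (∑ i, m i • KZ.of (R i)))
      (𝓝[>] (0 : ℝ) ⊓ 𝓟 {s : ℝ | KZ.sliceEval (∑ i, m i • KZ.of (R i)) s = 0}) (𝓝 0) := by
    refine (tendsto_const_nhds (x := (0 : ℝ))).congr' ?_
    have h1 : ∀ᶠ s in 𝓝[>] (0 : ℝ) ⊓ 𝓟 {s : ℝ | KZ.sliceEval (∑ i, m i • KZ.of (R i)) s = 0},
        s ∈ {s : ℝ | KZ.sliceEval (∑ i, m i • KZ.of (R i)) s = 0} :=
      mem_inf_of_right (mem_principal_self _)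
    filter_upwards [h1] with s hs
    exact hs.symm
  rw [heval]
  exact tendsto_nhds_unique (hN.mono_left hle) h0

/-- **The kernel conjecture ⇒ SF**: with `ker eval ⊆ relations`, the value shadow
`eval_specialFibre_eq_zero` puts the special-fibre class `Σ mᵢ [r₀ᵢ]` of a dominated fibred
relation into `KZ.relations`. [Kontsevich–Zagier 2001, §1.2 Conjecture 1; Huber–Müller-Stach 2017,
Conj. 13.2.1] [folklore] -/
theorem specialFibre_of_kzKernelConjecture (hK : KZKernelConjecture) :
    ∀ (k : ℕ) (d : Fin k → ℕ) (m : Fin k → ℤ) (R : (i : Fin k) → KZ.IntegralRep (d i + 1))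
      (r₀ g : (i : Fin k) → KZ.IntegralRep (d i)), (∀ i, KZ.IsDominatedFamily (R i) (r₀ i) (g i)) →
      (∑ i, m i • KZ.of (R i)) ∈ KZ.fibredRelations → (∑ i, m i • KZ.of (r₀ i)) ∈ KZ.relations :=
  fun _ _ m _ _ _ hR hG => hK _ (eval_specialFibre_eq_zero m hR hG)

/-- **Summit ⇒ SF** (`kzKernelConjecture_iff_isRational` and
`specialFibre_of_kzKernelConjecture`). [Kontsevich–Zagier 2001, §1.2 Conjecture 1] [folklore] -/
theorem specialFibre_of_kontsevichZagierPeriods (hKZ : KontsevichZagierPeriods) :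
    ∀ (k : ℕ) (d : Fin k → ℕ) (m : Fin k → ℤ) (R : (i : Fin k) → KZ.IntegralRep (d i + 1))
      (r₀ g : (i : Fin k) → KZ.IntegralRep (d i)), (∀ i, KZ.IsDominatedFamily (R i) (r₀ i) (g i)) →
      (∑ i, m i • KZ.of (R i)) ∈ KZ.fibredRelations → (∑ i, m i • KZ.of (r₀ i)) ∈ KZ.relations :=
  specialFibre_of_kzKernelConjecture (kzKernelConjecture_iff_isRational.mpr hKZ)

/-- **`CTConstruction` ⇒ SF**: the constant-term functor sends the fibred subgroup into
`KZ.relations` ((CT2) and `AddSubgroup.closure_le`) and each dominated family to its special fibre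
modulo relations ((CT3)); subtract. This is exactly the part of `CTConstruction` the route's assembly
uses. [Kontsevich–Zagier 2001, §1.2] [folklore] -/
theorem specialFibre_of_ctConstruction (hCT : CTConstruction) :
    ∀ (k : ℕ) (d : Fin k → ℕ) (m : Fin k → ℤ) (R : (i : Fin k) → KZ.IntegralRep (d i + 1))
      (r₀ g : (i : Fin k) → KZ.IntegralRep (d i)), (∀ i, KZ.IsDominatedFamily (R i) (r₀ i) (g i)) →
      (∑ i, m i • KZ.of (R i)) ∈ KZ.fibredRelations → (∑ i, m i • KZ.of (r₀ i)) ∈ KZ.relations := by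
  intro k d m R r₀ g hR hG
  obtain ⟨CT, -, hCT2, hCT3⟩ := hCT
  -- (CT2): the fibred generators go to relations, hence so does the fibred subgroup
  have hCTG : CT (∑ i, m i • KZ.of (R i)) ∈ KZ.relations := by
    have hle : KZ.fibredRelations ≤ KZ.relations.comap CT :=
      (AddSubgroup.closure_le _).mpr fun x hx => AddSubgroup.mem_comap.mpr (hCT2 x hx)
    exact AddSubgroup.mem_comap.mp (hle hG)
  -- (CT3): each dominated family specialises to its special fibre modulo relations
  have hCTG' : CT (∑ i, m i • KZ.of (R i)) - ∑ i, m i • KZ.of (r₀ i) ∈ KZ.relations := by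
    rw [map_sum, ← Finset.sum_sub_distrib]
    refine sum_mem fun i _ => ?_
    rw [map_zsmul, ← zsmul_sub]
    exact AddSubgroup.zsmul_mem _ (hCT3 (d i) (R i) (r₀ i) (g i) (hR i)) (m i)
  have h := KZ.relations.sub_mem hCTG hCTG'
  rwa [sub_sub_cancel] at h

/-- **SF ⇒ `ParametricLifting` ⇒ summit** (the route's assembly with `CTConstruction` weakened to
its special-fibre consequence SF): for rational `r`, `r'` with equal value, PL gives a fibred
relation `Σ mᵢ [Rᵢ]` with dominated net and `Σ mᵢ [r₀ᵢ] − ([r] − [r']) ∈ relations`; SF gives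
`Σ mᵢ [r₀ᵢ] ∈ relations`; subtract. [Kontsevich–Zagier 2001, §1.2 Conjecture 1] [folklore] -/
theorem kontsevichZagierPeriods_of_specialFibre_of_parametricLifting
    (hSF : ∀ (k : ℕ) (d : Fin k → ℕ) (m : Fin k → ℤ) (R : (i : Fin k) → KZ.IntegralRep (d i + 1))
      (r₀ g : (i : Fin k) → KZ.IntegralRep (d i)), (∀ i, KZ.IsDominatedFamily (R i) (r₀ i) (g i)) →
      (∑ i, m i • KZ.of (R i)) ∈ KZ.fibredRelations → (∑ i, m i • KZ.of (r₀ i)) ∈ KZ.relations)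
    (hPL : ParametricLifting) : KontsevichZagierPeriods := by
  intro n n' r r' hr hr' hv
  change KZ.of r - KZ.of r' ∈ KZ.relations
  obtain ⟨G, hG, k, d, m, R, r₀, g, hdom, rfl, hfib⟩ := hPL r r' hr hr' hv
  have h := KZ.relations.sub_mem (hSF k d m R r₀ g hdom hG) hfib
  rwa [sub_sub_cancel] at h

/-- **Summit ⇔ `ParametricLifting` ∧ SF**: route ValuedFieldSpecialisation's cut of Conjecture 1 into
"lift an equal-valued rational pair to a fibred relation with dominated net" (the open core PL) and
"special fibres of dominated fibred relations are relations" (SF, delivered by `CTConstruction`) is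
lossless — each half is a consequence of the summit and together they give it back.
[Kontsevich–Zagier 2001, §1.2 Conjecture 1] [folklore] -/
theorem kontsevichZagierPeriods_iff_parametricLifting_and_specialFibre :
    KontsevichZagierPeriods ↔ Summit.KontsevichZagierPeriods.KontsevichZagierPeriods.Theses.ValuedFieldSpecialisation.ParametricLifting ∧ ∀ (k : ℕ) (d : Fin k → ℕ) (m : Fin k → ℤ) (R : (i : Fin k) → KZ.IntegralRep (d i + 1)) (r₀ g : (i : Fin k) → KZ.IntegralRep (d i)), (∀ i, KZ.IsDominatedFamily (R i) (r₀ i) (g i)) → (∑ i, m i • KZ.of (R i)) ∈ KZ.fibredRelations → (∑ i, m i • KZ.of (r₀ i)) ∈ KZ.relations :=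
  ⟨fun h => ⟨parametricLifting_of_kontsevichZagierPeriods h, specialFibre_of_kontsevichZagierPeriods h⟩,
    fun h => kontsevichZagierPeriods_of_specialFibre_of_parametricLifting h.2 h.1⟩

end Summit.KontsevichZagierPeriods.ValuedFieldSpecialisation
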